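import Literature.MathematicalPhysics.QuantumLattice.HubbardOpenBoxEDUpperCertificate
import HarnessLib

/-!
# Upper certificates: the NESTED form of the kernel checker

Topic `MathematicalPhysics/QuantumLattice`, family `hubbard`. `UpperCert.check`
(`HubbardOpenBoxEDUpperCertificate`) runs its outer loops over all `4^{ab}` occupation codes as ONE
structural loop, which the kernel unfolds to recursion depth `4^{ab}` — too deep already for the `2 × 4`
cluster (`65536`). This file splits every outer loop into two nested loops of length `2^{ab}`
(`sumNat_mul`, `allNat_mul`: `Σ_{m < MK} f m = Σ_{i < M} Σ_{j < K} f (iK + j)`), defines the nested checker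
`UpperCert.check₂` and proves `check₂ = check` (`UpperCert.check₂_eq`), whence **`UpperCert.sound₂`** with
the conclusion of `UpperCert.sound`. Nothing numerical; everything proved.

## References

* A. Neumaier, *Complete search in continuous global optimization and constraint satisfaction*, Acta
  Numerica 13 (2004), §11 (exact-arithmetic certificate checking by evaluation). [cite: Neumaier2004CompleteSearch, §11]
* D. Ruelle, *Statistical Mechanics: Rigorous Results* (1969), §3.3. [cite: Ruelle1969, §3.3]
-/

namespace Literature.MathematicalPhysics.QuantumLattice

namespace OccupationCode

open Finset

/-- `Σ_{m < n + k} f m = Σ_{m < n} f m + Σ_{j < k} f (n + j)`. [cite: Neumaier2004CompleteSearch, §11] -/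
theorem sumNat_add {α : Type*} [AddCommMonoid α] (f : ℕ → α) (n : ℕ) :
    ∀ k : ℕ, sumNat f (n + k) = sumNat f n + sumNat (fun j => f (n + j)) k
  | 0 => by simp [sumNat]
  | k + 1 => by
    rw [← Nat.add_assoc, sumNat, sumNat_add f n k, sumNat, add_assoc]

/-- **Loop splitting**: `Σ_{m < M·K} f m = Σ_{i < M} Σ_{j < K} f (i·K + j)`. [cite: Neumaier2004CompleteSearch, §11] -/
theorem sumNat_mul {α : Type*} [AddCommMonoid α] (f : ℕ → α) (K : ℕ) :
    ∀ M : ℕ, sumNat f (M * K) = sumNat (fun i => sumNat (fun j => f (i * K + j)) K) M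
  | 0 => by simp [sumNat]
  | M + 1 => by
    rw [Nat.succ_mul, sumNat_add, sumNat_mul f K M, sumNat]

/-- `(∀ m < n + k, f m) = (∀ m < n, f m) ∧ (∀ j < k, f (n + j))` for the structural `allNat`.
[cite: Neumaier2004CompleteSearch, §11] -/
theorem allNat_add (f : ℕ → Bool) (n : ℕ) :
    ∀ k : ℕ, allNat f (n + k) = (allNat f n && allNat (fun j => f (n + j)) k)
  | 0 => by simp [allNat]
  | k + 1 => by
    rw [← Nat.add_assoc, allNat, allNat_add f n k, allNat, Bool.and_assoc]

/-- **Loop splitting for `allNat`**: `allNat f (M·K) = allNat (fun i => allNat (fun j => f (i·K + j)) K) M`.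
[cite: Neumaier2004CompleteSearch, §11] -/
theorem allNat_mul (f : ℕ → Bool) (K : ℕ) :
    ∀ M : ℕ, allNat f (M * K) = allNat (fun i => allNat (fun j => f (i * K + j)) K) M
  | 0 => by simp [allNat]
  | M + 1 => by
    rw [Nat.succ_mul, allNat_add, allNat_mul f K M, allNat]

/-- `4^n = 2^n · 2^n`. [folklore] -/
private theorem four_pow_eq (n : ℕ) : 4 ^ n = 2 ^ n * 2 ^ n := by
  rw [← mul_pow]; norm_num

namespace UpperCert

variable (C : UpperCert)

/-- Nested form of `SHop`. [cite: Neumaier2004CompleteSearch, §11] -/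
def SHop₂ (adj : ℕ → ℕ → Bool) (a b : ℕ) : ℤ :=
  sumNat (fun i => sumNat (fun j =>
    if C.fAt (i * 2 ^ (a * b) + j) = 0 then 0 else
      C.fAt (i * 2 ^ (a * b) + j) * openBoxHopApply adj (a * b) (i * 2 ^ (a * b) + j) C.fAt) (2 ^ (a * b))) (2 ^ (a * b))

/-- Nested form of `SD`. [cite: Neumaier2004CompleteSearch, §11] -/
def SD₂ (a b : ℕ) : ℤ :=
  sumNat (fun i => sumNat (fun j =>
    if C.fAt (i * 2 ^ (a * b) + j) = 0 then 0 else
      doccOf (a * b) (i * 2 ^ (a * b) + j) * (C.fAt (i * 2 ^ (a * b) + j) * C.fAt (i * 2 ^ (a * b) + j)))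
    (2 ^ (a * b))) (2 ^ (a * b))

/-- Nested form of `NN`. [cite: Neumaier2004CompleteSearch, §11] -/
def NN₂ (a b : ℕ) : ℤ :=
  sumNat (fun i => sumNat (fun j => C.fAt (i * 2 ^ (a * b) + j) * C.fAt (i * 2 ^ (a * b) + j)) (2 ^ (a * b))) (2 ^ (a * b))

/-- `SHop₂ = SHop`. [cite: Neumaier2004CompleteSearch, §11] -/
theorem SHop₂_eq (adj : ℕ → ℕ → Bool) (a b : ℕ) : C.SHop₂ adj a b = C.SHop adj a b := by
  rw [SHop, four_pow_eq, sumNat_mul]; rfl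

/-- `SD₂ = SD`. [cite: Neumaier2004CompleteSearch, §11] -/
theorem SD₂_eq (a b : ℕ) : C.SD₂ a b = C.SD a b := by
  rw [SD, four_pow_eq, sumNat_mul]; rfl

/-- `NN₂ = NN`. [cite: Neumaier2004CompleteSearch, §11] -/
theorem NN₂_eq (a b : ℕ) : C.NN₂ a b = C.NN a b := by
  rw [NN, four_pow_eq, sumNat_mul]; rfl

/-- **The nested kernel checker** (recursion depth `2^{ab}` instead of `4^{ab}`). [cite: Neumaier2004CompleteSearch, §11] -/
def check₂ (a b N : ℕ) (EK EP EM ED : ℚ) : Bool :=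
  decide (0 < C.NN₂ a b) &&
    allNat (fun i => allNat (fun j => decide (upCount (a * b) (i * 2 ^ (a * b) + j) + dnCount (a * b) (i * 2 ^ (a * b) + j) = N)
      || decide (C.fAt (i * 2 ^ (a * b) + j) = 0)) (2 ^ (a * b))) (2 ^ (a * b)) &&
    decide ((-(C.SHop₂ (nnAdjCode b) a b) : ℚ) ≤ EK * C.NN₂ a b) &&
    decide ((-(C.SHop₂ (diagAdjCode b) a b) : ℚ) ≤ EP * C.NN₂ a b) &&
    decide (((C.SHop₂ (diagAdjCode b) a b) : ℚ) ≤ EM * C.NN₂ a b) &&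
    decide (((C.SD₂ a b) : ℚ) ≤ ED * C.NN₂ a b)

/-- The nested checker IS the checker. [cite: Neumaier2004CompleteSearch, §11] -/
theorem check₂_eq (a b N : ℕ) (EK EP EM ED : ℚ) : C.check₂ a b N EK EP EM ED = C.check a b N EK EP EM ED := by
  rw [check₂, check, SHop₂_eq, SHop₂_eq, SD₂_eq, NN₂_eq, four_pow_eq, allNat_mul]

/-- **SOUNDNESS of the nested checker**: as `UpperCert.sound`. [cite: Ruelle1969, §3.3] -/
theorem sound₂ {a b N : ℕ} {EK EP EM ED : ℚ} (h : C.check₂ a b N EK EP EM ED = true) (ha : 1 ≤ a) (hb : 1 ≤ b)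
    (hN : N < 2 * (a * b)) (t' : ℝ) {U : ℝ} (hU : 0 ≤ U) :
    ThermodynamicLimit.energyDensityTT' 1 t' U ((N : ℝ) / ((a : ℝ) * (b : ℝ))) ≤
      ((EK : ℝ) + max (t' * EP) (-t' * EM) + U * ED) / ((a : ℝ) * (b : ℝ)) :=
  C.sound (by rw [← check₂_eq]; exact h) ha hb hN t' hU

end UpperCert

end OccupationCode

end Literature.MathematicalPhysics.QuantumLattice
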